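import Summits.AtomisticToContinuum.HydrodynamicLimit.Theorems.InformationPercolationEngineKickFairRelEquilibriumMesoTransferCoreB
import Literature.Analysis.FluidPDE.RusinSverakGaugePatching

/-!
# `KickFairRelEquilibriumMeso`, line `Sketch` — glue T, part (d3): the non-kept level set and the core estimate

Helper file (`--supports stmt-AtomisticToContinuum-15177`) of the line lead for the registered glue stub
`stub_pinchTransfer` (registered sub-goal here: `transferNonkept`). `nonkept_levelSet_bound`: on a level set of
`LG`-mass `< e^{-η(N+1)}`, `Σ_k ∫ |Z_k| dLG ≤ ∫ 2C_g countFn dLG ≤ NK = 4C_g(λ+1)Λs² e^{-η(N+1)}` (conditional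
domination when `G_{θ₁}(Bz) ≥ e^{-M₁(N+1)}`, global domination and the tail otherwise). `core_estimate`: at fixed `N`,
with the conclusions of the six stubs at this `N` as hypotheses, cut the high-energy region (global domination + E2 +
E1), tile `(0, τ]` into `m` windows (`transferSlots`), split the low-energy region into the finitely many level sets
of KC, and add up the kept (part d2) and non-kept bounds:
`∫ |S| dLG ≤ m(δ′ + 1/L)t_N + 2C_g(λ+1)e^{-(N+1)} + m·KX + #s·NK`.
-/

noncomputable section

open MeasureTheory Set Filter Topology
open scoped ENNReal Classical

namespace Summit.AtomisticToContinuum.HydrodynamicLimit.Theorems.KickFairRelEquilibriumMesoLine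

open Literature.Analysis.FluidPDE Literature.MathematicalPhysics.KineticTheory
open Summit.AtomisticToContinuum.HydrodynamicLimit.Theorems

variable {σ : ℝ} {N : ℕ}
/-! ## The estimate on one level set: kept case (one window) and non-kept case (all windows) -/

section LevelSet

variable {Φ : Flow σ N} {a₀ θ₀ : T3 → ℝ} {u₀ : T3 → V3} {θ₁ : ℝ} {z₀ : Phase N}

local notation "μL" => localGibbsLaw σ a₀ u₀ θ₀ N Φ
local notation "νL" => localGibbsLaw σ (fun _ => (1 : ℝ)) (fun _ => (0 : V3)) (fun _ => (1 : ℝ)) N Φ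
local notation "νT" => localGibbsLaw σ (fun _ => (1 : ℝ)) (fun _ => (0 : V3)) (fun _ => θ₁) N Φ
local notation "Bz" => keyLevel N z₀
/-- **Non-kept level set, all windows.** If `LG(Bz) < e^{-η(N+1)}` then
`Σ_{k<m} ∫_{Bz} |Z_k| dLG ≤ NK = 4C_g(λ+1) Λs² e^{-η(N+1)}` (conditional domination when `G_{θ₁}(Bz) ≥ e^{-M₁(N+1)}`,
global domination and the tail otherwise). [folklore] -/
theorem nonkept_levelSet_bound (hPM : PastMeasurable) (hσ : 0 < σ) (hσ2 : σ ≤ 1 / 2)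
    (hθ₁ : 0 < θ₁) {Λ : ℝ} (hΛ : 1 ≤ Λ) (hdom : (μL) ≤ ENNReal.ofReal (Λ ^ (N + 1)) • (νT))
    {τ : ℝ} (hτ : 0 < τ) {g : V3 × V3 × V3 → ℝ} (hg : Continuous g) {Cg : ℝ} (hCg : ∀ p, |g p| ≤ Cg)
    {h : Fin (N + 1) → ℕ → Past N → ℝ} (hh : ∀ i n, Measurable (h i n)) (hhb : ∀ i n p, |h i n p| ≤ 1)
    {lam M₁ : ℝ} (hlam : 0 ≤ lam)
    (hE1N : ∫⁻ z in {z | lam < countFn Φ τ z}, ENNReal.ofReal (countFn Φ τ z) ∂(νT) ≤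
      ENNReal.ofReal (Real.exp (-(M₁ * ((N : ℝ) + 1)))))
    {Λs : ℝ} (hΛs1 : 1 ≤ Λs)
    (TB : ∀ F : Phase N → ℝ≥0∞, Measurable F →
      ((νL) Bz * ∫⁻ z in Bz, F z ∂(μL) ≤ ENNReal.ofReal Λs * (μL) Bz * ∫⁻ z in Bz, F z ∂(νL)) ∧
      ((νT) Bz * ∫⁻ z in Bz, F z ∂(νL) ≤ ENNReal.ofReal Λs * (νL) Bz * ∫⁻ z in Bz, F z ∂(νT)) ∧
      ((νL) Bz * ∫⁻ z in Bz, F z ∂(νT) ≤ ENNReal.ofReal Λs * (νT) Bz * ∫⁻ z in Bz, F z ∂(νL)))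
    {η : ℝ} {m : ℕ} (hm : 0 < m)
    (hkept : (μL) Bz < ENNReal.ofReal (Real.exp (-(η * ((N : ℝ) + 1)))))
    (hM₁ : Real.log Λ + η + 3 ≤ M₁) :
    ∑ k ∈ Finset.range m, ∫⁻ z in Bz, ENNReal.ofReal |slotSum Φ τ (rs N) (wEnd τ m k) (wEnd τ m (k + 1)) g h z| ∂(μL) ≤
      ENNReal.ofReal (4 * Cg * (lam + 1) * Λs ^ 2 * Real.exp (-(η * ((N : ℝ) + 1)))) := by
  set μ : Measure (Phase N) := μL with hμdef
  set ν : Measure (Phase N) := νL with hνdef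
  set ν' : Measure (Phase N) := νT with hν'def
  have hCg0 : 0 ≤ Cg := (abs_nonneg _).trans (hCg 0)
  haveI : IsProbabilityMeasure ν' := isProbabilityMeasure_localGibbsLaw continuous_const continuous_const
    continuous_const (fun _ => one_pos) (fun _ => hθ₁) hσ2 N Φ
  haveI : IsProbabilityMeasure ν := isProbabilityMeasure_localGibbsLaw continuous_const continuous_const
    continuous_const (fun _ => one_pos) (fun _ => one_pos) hσ2 N Φ
  have hμν : μ ≪ ν := localGibbsLaw_absolutelyContinuous_localGibbsLaw continuous_const continuous_const
    continuous_const (fun _ => one_pos) (fun _ => one_pos) a₀ u₀ θ₀ hσ2 N Φ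
  have hν'ν : ν' ≪ ν := localGibbsLaw_absolutelyContinuous_localGibbsLaw continuous_const continuous_const
    continuous_const (fun _ => one_pos) (fun _ => one_pos) _ _ _ hσ2 N Φ
  have hgood : ∀ {ρ : Measure (Phase N)}, ρ Φ.goodᶜ = 0 → ∀ᵐ z ∂ρ, z ∈ Φ.good := fun h0 => mem_ae_iff.2 h0
  have hμg : μ Φ.goodᶜ = 0 := localGibbsLaw_compl_good_eq_zero Φ
  have hκν : ∀ᵐ z ∂ν, ∀ i : Fin (N + 1), ∀ n : ℕ, |kappa Φ (rs N) g i n z| ≤ Cg :=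
    ae_forall_abs_kappa_le Φ (rs N) hCg
  have hκμ : ∀ᵐ z ∂μ, ∀ i : Fin (N + 1), ∀ n : ℕ, |kappa Φ (rs N) g i n z| ≤ Cg := hμν.ae_le hκν
  have hWm : Measurable (countFn Φ τ) := measurable_countFn hPM hσ Φ τ
  have hWm' : Measurable fun z => ENNReal.ofReal (2 * Cg * countFn Φ τ z) := (hWm.const_mul _).ennreal_ofReal
  have hBzm : MeasurableSet Bz := measurableSet_keyLevel z₀
  have hνtop : ν Bz ≠ ⊤ := measure_ne_top _ _
  have hν'top : ν' Bz ≠ ⊤ := measure_ne_top _ _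
  have hF : ∀ k, AEMeasurable (fun z => ENNReal.ofReal |slotSum Φ τ (rs N) (wEnd τ m k) (wEnd τ m (k + 1)) g h z|) μ :=
    fun k => (continuous_abs.measurable.comp_aemeasurable
      (aestronglyMeasurable_slotSum hPM hσ Φ τ (rs N) _ _ hg hh hμg).aemeasurable).ennreal_ofReal
  -- Σ_k |Z_k| ≤ W a.e.
  have hsumW : ∑ k ∈ Finset.range m, ∫⁻ z in Bz, ENNReal.ofReal
      |slotSum Φ τ (rs N) (wEnd τ m k) (wEnd τ m (k + 1)) g h z| ∂μ ≤
      ∫⁻ z in Bz, ENNReal.ofReal (2 * Cg * countFn Φ τ z) ∂μ := by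
    rw [← lintegral_finsetSum' _ fun k _ => (hF k).restrict]
    refine lintegral_mono_ae (ae_restrict_of_ae ?_)
    filter_upwards [hgood hμg, hκμ] with z hz hκz
    rw [← ENNReal.ofReal_sum_of_nonneg fun k _ => abs_nonneg _]
    exact ENNReal.ofReal_le_ofReal (sum_abs_slotSum_le_of_kappa_le Φ hσ hτ (rs N) hCg hhb hm hz hκz)
  have hWsplit : ∀ A : Set (Phase N), ∫⁻ z in A, ENNReal.ofReal (2 * Cg * countFn Φ τ z) ∂ν' ≤
      ENNReal.ofReal (2 * Cg * lam) * ν' A + ENNReal.ofReal (2 * Cg) *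
        ENNReal.ofReal (Real.exp (-(M₁ * ((N : ℝ) + 1)))) := fun A =>
    (setLIntegral_W_le (ν := ν') Φ τ lam hCg0 hWm A).trans (by gcongr)
  refine hsumW.trans ?_
  have hexp0 := (Real.exp_pos (-(η * ((N : ℝ) + 1)))).le
  by_cases hα : ENNReal.ofReal (Real.exp (-(M₁ * ((N : ℝ) + 1)))) ≤ ν' Bz
  · -- conditional domination μ → ν' through ν
    have hν'B0 : ν' Bz ≠ 0 := fun h0 => by
      rw [h0, nonpos_iff_eq_zero, ENNReal.ofReal_eq_zero] at hα
      exact absurd hα (not_le.2 (Real.exp_pos _))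
    have hνB0 : ν Bz ≠ 0 := fun h0 => hν'B0 (hν'ν h0)
    obtain ⟨TB1, TB2, -⟩ := TB _ hWm'
    have h1 : ν' Bz * ∫⁻ z in Bz, ENNReal.ofReal (2 * Cg * countFn Φ τ z) ∂μ ≤
        ENNReal.ofReal Λs * ENNReal.ofReal Λs * μ Bz * ∫⁻ z in Bz, ENNReal.ofReal (2 * Cg * countFn Φ τ z) ∂ν' :=
      chain_cancel hνB0 hνtop TB1 TB2
    have h2 : ∫⁻ z in Bz, ENNReal.ofReal (2 * Cg * countFn Φ τ z) ∂ν' ≤ ENNReal.ofReal (2 * Cg * (lam + 1)) * ν' Bz := by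
      calc ∫⁻ z in Bz, ENNReal.ofReal (2 * Cg * countFn Φ τ z) ∂ν'
          ≤ ENNReal.ofReal (2 * Cg * lam) * ν' Bz + ENNReal.ofReal (2 * Cg) *
              ENNReal.ofReal (Real.exp (-(M₁ * ((N : ℝ) + 1)))) := hWsplit _
        _ ≤ ENNReal.ofReal (2 * Cg * lam) * ν' Bz + ENNReal.ofReal (2 * Cg) * ν' Bz := by gcongr
        _ = ENNReal.ofReal (2 * Cg * (lam + 1)) * ν' Bz := by
            rw [← add_mul, ← ENNReal.ofReal_add (mul_nonneg (by positivity) hlam) (by positivity)]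
            congr 1; congr 1; ring
    have h3 : ν' Bz * ∫⁻ z in Bz, ENNReal.ofReal (2 * Cg * countFn Φ τ z) ∂μ ≤
        (ENNReal.ofReal Λs * ENNReal.ofReal Λs * ENNReal.ofReal (2 * Cg * (lam + 1)) * μ Bz) * ν' Bz := by
      calc ν' Bz * ∫⁻ z in Bz, ENNReal.ofReal (2 * Cg * countFn Φ τ z) ∂μ
          ≤ ENNReal.ofReal Λs * ENNReal.ofReal Λs * μ Bz * (ENNReal.ofReal (2 * Cg * (lam + 1)) * ν' Bz) :=
            h1.trans (mul_le_mul_right h2 _)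
        _ = _ := by ring
    refine (cancel_mass hν'B0 hν'top h3).trans ?_
    calc ENNReal.ofReal Λs * ENNReal.ofReal Λs * ENNReal.ofReal (2 * Cg * (lam + 1)) * μ Bz
        ≤ ENNReal.ofReal Λs * ENNReal.ofReal Λs * ENNReal.ofReal (2 * Cg * (lam + 1)) *
            ENNReal.ofReal (Real.exp (-(η * ((N : ℝ) + 1)))) := mul_le_mul_right hkept.le _
      _ = ENNReal.ofReal (Λs * Λs * (2 * Cg * (lam + 1)) * Real.exp (-(η * ((N : ℝ) + 1)))) := by
          rw [← ENNReal.ofReal_mul (by linarith), ← ENNReal.ofReal_mul (by positivity),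
            ← ENNReal.ofReal_mul (by positivity)]
      _ ≤ _ := by
          refine ENNReal.ofReal_le_ofReal ?_
          have hΛs0 : 0 ≤ Λs := by linarith
          nlinarith [mul_nonneg (mul_nonneg (mul_nonneg (mul_nonneg hΛs0 hΛs0) hCg0)
            (by linarith : (0 : ℝ) ≤ lam + 1)) hexp0]
  · -- global domination and the tail
    rw [not_le] at hα
    have e1 : Λ ^ (N + 1) * Real.exp (-(M₁ * ((N : ℝ) + 1))) ≤ Real.exp (-(η * ((N : ℝ) + 1))) :=
      pow_mul_exp_neg_le hΛ (by linarith) N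
    calc ∫⁻ z in Bz, ENNReal.ofReal (2 * Cg * countFn Φ τ z) ∂μ
        ≤ ∫⁻ z in Bz, ENNReal.ofReal (2 * Cg * countFn Φ τ z) ∂(ENNReal.ofReal (Λ ^ (N + 1)) • ν') :=
          lintegral_mono' (Measure.restrict_mono subset_rfl hdom) le_rfl
      _ = ENNReal.ofReal (Λ ^ (N + 1)) * ∫⁻ z in Bz, ENNReal.ofReal (2 * Cg * countFn Φ τ z) ∂ν' := by
          rw [Measure.restrict_smul, lintegral_smul_measure, smul_eq_mul]
      _ ≤ ENNReal.ofReal (Λ ^ (N + 1)) * (ENNReal.ofReal (2 * Cg * lam) * ν' Bz + ENNReal.ofReal (2 * Cg) *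
            ENNReal.ofReal (Real.exp (-(M₁ * ((N : ℝ) + 1))))) := mul_le_mul_right (hWsplit _) _
      _ ≤ ENNReal.ofReal (Λ ^ (N + 1)) * (ENNReal.ofReal (2 * Cg * lam) *
            ENNReal.ofReal (Real.exp (-(M₁ * ((N : ℝ) + 1)))) + ENNReal.ofReal (2 * Cg) *
            ENNReal.ofReal (Real.exp (-(M₁ * ((N : ℝ) + 1))))) := by gcongr
      _ = ENNReal.ofReal (2 * Cg * (lam + 1) * (Λ ^ (N + 1) * Real.exp (-(M₁ * ((N : ℝ) + 1))))) := by
          rw [← ENNReal.ofReal_mul (mul_nonneg (by positivity) hlam), ← ENNReal.ofReal_mul (by positivity),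
            ← ENNReal.ofReal_add (by positivity) (by positivity), ← ENNReal.ofReal_mul (by positivity)]
          congr 1; ring
      _ ≤ _ := by
          refine ENNReal.ofReal_le_ofReal ?_
          have hsq : 1 ≤ Λs ^ 2 := by nlinarith
          have hB : 0 ≤ 2 * Cg * (lam + 1) := by positivity
          nlinarith [mul_le_mul_of_nonneg_left e1 hB, mul_nonneg hB hexp0,
            mul_le_mul_of_nonneg_left hsq (mul_nonneg hB hexp0)]

end LevelSet

/-! ## The core estimate -/

/-- **The core estimate at fixed `N`.** See the module docstring. [folklore] -/
theorem core_estimate (hPM : PastMeasurable) (hσ : 0 < σ) (hσ2 : σ ≤ 1 / 2) (Φ : Flow σ N)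
    {a₀ θ₀ : T3 → ℝ} {u₀ : T3 → V3} (ha : Continuous a₀) (hθ : Continuous θ₀) (hu : Continuous u₀)
    (ha0 : ∀ x, 0 < a₀ x) (hθ0 : ∀ x, 0 < θ₀ x) {θ₁ Λ : ℝ} (hθ₁ : 0 < θ₁) (hΛ : 1 ≤ Λ)
    (hdomG : localGibbsMeasure σ a₀ u₀ θ₀ N ≤
      ENNReal.ofReal (Λ ^ (N + 1)) • localGibbsMeasure σ (fun _ => 1) (fun _ => (0 : V3)) (fun _ => θ₁) N)
    {τ : ℝ} (hτ : 0 < τ) {g : V3 × V3 × V3 → ℝ} (hg : Continuous g) {Cg : ℝ} (hCg : ∀ p, |g p| ≤ Cg)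
    {h : Fin (N + 1) → ℕ → Past N → ℝ} (hh : ∀ i n, Measurable (h i n)) (hhb : ∀ i n p, |h i n p| ≤ 1)
    {K₀ M₂ : ℝ} (hK₀ : 0 ≤ K₀)
    (hE2N : localGibbsLaw σ (fun _ => 1) (fun _ => 0) (fun _ => θ₁) N Φ {z | K₀ * ((N : ℝ) + 1) < kinEnergy z} ≤
      ENNReal.ofReal (Real.exp (-(M₂ * ((N : ℝ) + 1)))))
    {lam M₁ : ℝ} (hlam : 0 ≤ lam)
    (hE1N : ∫⁻ z in {z | lam < countFn Φ τ z}, ENNReal.ofReal (countFn Φ τ z)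
        ∂(localGibbsLaw σ (fun _ => 1) (fun _ => 0) (fun _ => θ₁) N Φ) ≤
      ENNReal.ofReal (Real.exp (-(M₁ * ((N : ℝ) + 1)))))
    {ηp : ℝ} (hηp : 0 < ηp)
    (hS1N : ∀ z z' : Phase N, cellKey (rs N) (rs N) z = cellKey (rs N) (rs N) z' →
      canonicalDensity (Torus.geometry (Fin 3)) (hsDiameter σ N) (N + 1) (localGibbsProfile a₀ u₀ θ₀) z *
        canonicalDensity (Torus.geometry (Fin 3)) (hsDiameter σ N) (N + 1)
          (localGibbsProfile (fun _ => 1) (fun _ => 0) (fun _ => 1)) z' ≤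
      Real.exp (ηp * (((N : ℝ) + 1) + kinEnergy z + kinEnergy z')) *
        (canonicalDensity (Torus.geometry (Fin 3)) (hsDiameter σ N) (N + 1) (localGibbsProfile a₀ u₀ θ₀) z' *
          canonicalDensity (Torus.geometry (Fin 3)) (hsDiameter σ N) (N + 1)
            (localGibbsProfile (fun _ => 1) (fun _ => 0) (fun _ => 1)) z))
    (hS2N : ∀ z z' : Phase N, cellKey (rs N) (rs N) z = cellKey (rs N) (rs N) z' →
      canonicalDensity (Torus.geometry (Fin 3)) (hsDiameter σ N) (N + 1)
          (localGibbsProfile (fun _ => 1) (fun _ => 0) (fun _ => θ₁)) z *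
        canonicalDensity (Torus.geometry (Fin 3)) (hsDiameter σ N) (N + 1)
          (localGibbsProfile (fun _ => 1) (fun _ => 0) (fun _ => 1)) z' ≤
      Real.exp (ηp * (((N : ℝ) + 1) + kinEnergy z + kinEnergy z')) *
        (canonicalDensity (Torus.geometry (Fin 3)) (hsDiameter σ N) (N + 1)
            (localGibbsProfile (fun _ => 1) (fun _ => 0) (fun _ => θ₁)) z' *
          canonicalDensity (Torus.geometry (Fin 3)) (hsDiameter σ N) (N + 1)
            (localGibbsProfile (fun _ => 1) (fun _ => 0) (fun _ => 1)) z))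
    (s : Finset ((Fin 3 → ℤ) → ℕ × (Fin 3 → ℤ) × ℤ))
    (hs : ∀ z : Phase N, kinEnergy z ≤ K₀ * ((N : ℝ) + 1) → cellKey (rs N) (rs N) z ∈ s)
    {δ' L c η : ℝ} (hδ' : 0 < δ') (hL : 0 < L) (hη : 0 < η)
    {m : ℕ} (hm : 0 < m)
    (hRN : ∀ k, k < m → ∀ z₀ : Phase N,
      ENNReal.ofReal (Real.exp (-(η * ((N : ℝ) + 1)))) ≤ localGibbsLaw σ a₀ u₀ θ₀ N Φ (keyLevel N z₀) →
      |∫ z in keyLevel N z₀, slotSum Φ τ (rs N) (wEnd τ m k) (wEnd τ m (k + 1)) g h z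
          ∂(localGibbsLaw σ (fun _ => 1) (fun _ => 0) (fun _ => 1) N Φ)| ≤
        δ' * tN N * (localGibbsLaw σ (fun _ => 1) (fun _ => 0) (fun _ => 1) N Φ (keyLevel N z₀)).toReal ∧
      localGibbsLaw σ (fun _ => 1) (fun _ => 0) (fun _ => 1) N Φ
          (keyLevel N z₀ ∩ {z | tN N / L < |slotSum Φ τ (rs N) (wEnd τ m k) (wEnd τ m (k + 1)) g h z -
              (localGibbsLaw σ (fun _ => 1) (fun _ => 0) (fun _ => 1) N Φ (keyLevel N z₀)).toReal⁻¹ *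
                ∫ z in keyLevel N z₀, slotSum Φ τ (rs N) (wEnd τ m k) (wEnd τ m (k + 1)) g h z
                  ∂(localGibbsLaw σ (fun _ => 1) (fun _ => 0) (fun _ => 1) N Φ)|}) ≤
        ENNReal.ofReal (Real.exp (-(c * ((N : ℝ) + 1)))) *
          localGibbsLaw σ (fun _ => 1) (fun _ => 0) (fun _ => 1) N Φ (keyLevel N z₀))
    (hM₁ : Real.log Λ + η + 3 ≤ M₁) (hM₂ : Real.log Λ + 1 ≤ M₂) :
    ∫⁻ z, ENNReal.ofReal |fullSum Φ τ (rs N) g h z| ∂(localGibbsLaw σ a₀ u₀ θ₀ N Φ) ≤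
      ENNReal.ofReal ((m : ℝ) * ((δ' + 1 / L) * tN N)) +
      ENNReal.ofReal (2 * Cg * (lam + 1) * Real.exp (-((N : ℝ) + 1))) +
      ENNReal.ofReal ((m : ℝ) * (Real.exp (ηp * (1 + 2 * (K₀ + 1)) * ((N : ℝ) + 1)) ^ 3 *
        (2 * Cg * lam + δ' + 2 * Cg) * (Real.exp (-(c * ((N : ℝ) + 1))) + Real.exp (-(3 * ((N : ℝ) + 1)))))) +
      ENNReal.ofReal ((s.card : ℝ) * (4 * Cg * (lam + 1) * Real.exp (ηp * (1 + 2 * (K₀ + 1)) * ((N : ℝ) + 1)) ^ 2 *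
        Real.exp (-(η * ((N : ℝ) + 1))))) := by
  set Λs : ℝ := Real.exp (ηp * (1 + 2 * (K₀ + 1)) * ((N : ℝ) + 1)) with hΛs
  set KX : ℝ := Λs ^ 3 * (2 * Cg * lam + δ' + 2 * Cg) *
    (Real.exp (-(c * ((N : ℝ) + 1))) + Real.exp (-(3 * ((N : ℝ) + 1)))) with hKX
  set NK : ℝ := 4 * Cg * (lam + 1) * Λs ^ 2 * Real.exp (-(η * ((N : ℝ) + 1))) with hNK
  set μ : Measure (Phase N) := localGibbsLaw σ a₀ u₀ θ₀ N Φ with hμdef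
  set ν : Measure (Phase N) := localGibbsLaw σ (fun _ => 1) (fun _ => 0) (fun _ => 1) N Φ with hνdef
  set ν' : Measure (Phase N) := localGibbsLaw σ (fun _ => 1) (fun _ => 0) (fun _ => θ₁) N Φ with hν'def
  have hCg0 : 0 ≤ Cg := (abs_nonneg _).trans (hCg 0)
  have hΛs1 : 1 ≤ Λs := Real.one_le_exp (by positivity)
  have hKX0 : 0 ≤ KX := by positivity
  have hNK0 : 0 ≤ NK := by positivity
  haveI hμP : IsProbabilityMeasure μ := isProbabilityMeasure_localGibbsLaw ha hθ hu ha0 hθ0 hσ2 N Φ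
  have hμν : μ ≪ ν := localGibbsLaw_absolutelyContinuous_localGibbsLaw continuous_const continuous_const
    continuous_const (fun _ => one_pos) (fun _ => one_pos) a₀ u₀ θ₀ hσ2 N Φ
  have hdom : μ ≤ ENNReal.ofReal (Λ ^ (N + 1)) • ν' := by
    rw [hμdef, hν'def, localGibbsLaw_eq, localGibbsLaw_eq]; exact hdomG
  have hμg : μ Φ.goodᶜ = 0 := localGibbsLaw_compl_good_eq_zero Φ
  have hgoodμ : ∀ᵐ z ∂μ, z ∈ Φ.good := mem_ae_iff.2 hμg
  have hκμ : ∀ᵐ z ∂μ, ∀ i : Fin (N + 1), ∀ n : ℕ, |kappa Φ (rs N) g i n z| ≤ Cg :=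
    hμν.ae_le (ae_forall_abs_kappa_le Φ (rs N) hCg)
  have hWm : Measurable (countFn Φ τ) := measurable_countFn hPM hσ Φ τ
  -- windows
  set Z : ℕ → Phase N → ℝ := fun k => slotSum Φ τ (rs N) (wEnd τ m k) (wEnd τ m (k + 1)) g h with hZdef
  have hF : ∀ k, AEMeasurable (fun z => ENNReal.ofReal |Z k z|) μ := fun k =>
    (continuous_abs.measurable.comp_aemeasurable
      (aestronglyMeasurable_slotSum hPM hσ Φ τ (rs N) _ _ hg hh hμg).aemeasurable).ennreal_ofReal
  /- Step 1: split at the energy cap -/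
  set lowE : Set (Phase N) := {z | kinEnergy z ≤ K₀ * ((N : ℝ) + 1)} with hlowE
  have hlowEm : MeasurableSet lowE := measurableSet_le measurable_kinEnergy measurable_const
  have hlowEc : lowEᶜ = {z | K₀ * ((N : ℝ) + 1) < kinEnergy z} := by ext z; simp [hlowE, not_le]
  rw [← lintegral_add_compl (fun z => ENNReal.ofReal |fullSum Φ τ (rs N) g h z|) hlowEm]
  /- Step 2: the high-energy region -/
  have hHIGH : ∫⁻ z in lowEᶜ, ENNReal.ofReal |fullSum Φ τ (rs N) g h z| ∂μ ≤
      ENNReal.ofReal (2 * Cg * (lam + 1) * Real.exp (-((N : ℝ) + 1))) := by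
    have h1 : ∫⁻ z in lowEᶜ, ENNReal.ofReal |fullSum Φ τ (rs N) g h z| ∂μ ≤
        ∫⁻ z in lowEᶜ, ENNReal.ofReal (2 * Cg * countFn Φ τ z) ∂μ := by
      refine lintegral_mono_ae (ae_restrict_of_ae ?_)
      filter_upwards [hgoodμ, hκμ] with z hz hκz
      exact ENNReal.ofReal_le_ofReal (abs_fullSum_le_of_kappa_le Φ hσ hτ (rs N) hCg hhb hz hκz)
    have h2 : ∫⁻ z in lowEᶜ, ENNReal.ofReal (2 * Cg * countFn Φ τ z) ∂μ ≤
        ENNReal.ofReal (Λ ^ (N + 1)) * ∫⁻ z in lowEᶜ, ENNReal.ofReal (2 * Cg * countFn Φ τ z) ∂ν' := by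
      calc ∫⁻ z in lowEᶜ, ENNReal.ofReal (2 * Cg * countFn Φ τ z) ∂μ
          ≤ ∫⁻ z in lowEᶜ, ENNReal.ofReal (2 * Cg * countFn Φ τ z) ∂(ENNReal.ofReal (Λ ^ (N + 1)) • ν') :=
            lintegral_mono' (Measure.restrict_mono subset_rfl hdom) le_rfl
        _ = ENNReal.ofReal (Λ ^ (N + 1)) * ∫⁻ z in lowEᶜ, ENNReal.ofReal (2 * Cg * countFn Φ τ z) ∂ν' := by
            rw [Measure.restrict_smul, lintegral_smul_measure, smul_eq_mul]
    have h3 := setLIntegral_W_le (ν := ν') Φ τ lam hCg0 hWm lowEᶜ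
    have h4 : ν' lowEᶜ ≤ ENNReal.ofReal (Real.exp (-(M₂ * ((N : ℝ) + 1)))) := by rw [hlowEc]; exact hE2N
    calc ∫⁻ z in lowEᶜ, ENNReal.ofReal |fullSum Φ τ (rs N) g h z| ∂μ
        ≤ ENNReal.ofReal (Λ ^ (N + 1)) * (ENNReal.ofReal (2 * Cg * lam) * ν' lowEᶜ +
            ENNReal.ofReal (2 * Cg) * ∫⁻ z in {z | lam < countFn Φ τ z}, ENNReal.ofReal (countFn Φ τ z) ∂ν') :=
          h1.trans (h2.trans (mul_le_mul_right h3 _))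
      _ ≤ ENNReal.ofReal (Λ ^ (N + 1)) * (ENNReal.ofReal (2 * Cg * lam) *
            ENNReal.ofReal (Real.exp (-(M₂ * ((N : ℝ) + 1)))) +
            ENNReal.ofReal (2 * Cg) * ENNReal.ofReal (Real.exp (-(M₁ * ((N : ℝ) + 1))))) := by gcongr
      _ = ENNReal.ofReal (2 * Cg * lam * (Λ ^ (N + 1) * Real.exp (-(M₂ * ((N : ℝ) + 1)))) +
            2 * Cg * (Λ ^ (N + 1) * Real.exp (-(M₁ * ((N : ℝ) + 1))))) := by
          have hΛp : 0 ≤ Λ ^ (N + 1) := by positivity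
          rw [← ENNReal.ofReal_mul (mul_nonneg (by positivity) hlam), ← ENNReal.ofReal_mul (by positivity),
            ← ENNReal.ofReal_add (by positivity) (by positivity), ← ENNReal.ofReal_mul hΛp]
          congr 1; ring
      _ ≤ ENNReal.ofReal (2 * Cg * (lam + 1) * Real.exp (-((N : ℝ) + 1))) := by
          refine ENNReal.ofReal_le_ofReal ?_
          have e2 : Λ ^ (N + 1) * Real.exp (-(M₂ * ((N : ℝ) + 1))) ≤ Real.exp (-(1 * ((N : ℝ) + 1))) :=
            pow_mul_exp_neg_le hΛ (by linarith) N
          have e1 : Λ ^ (N + 1) * Real.exp (-(M₁ * ((N : ℝ) + 1))) ≤ Real.exp (-(1 * ((N : ℝ) + 1))) :=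
            pow_mul_exp_neg_le hΛ (by linarith) N
          rw [one_mul] at e1 e2
          nlinarith [mul_le_mul_of_nonneg_left e2 (mul_nonneg (by positivity : (0 : ℝ) ≤ 2 * Cg) hlam),
            mul_le_mul_of_nonneg_left e1 (by positivity : (0 : ℝ) ≤ 2 * Cg)]
  /- Step 3: the low-energy region, into windows and level sets -/
  set s' := s.filter (fun β => ∃ z : Phase N, kinEnergy z ≤ K₀ * ((N : ℝ) + 1) ∧ cellKey (rs N) (rs N) z = β)
    with hs'
  set B : ((Fin 3 → ℤ) → ℕ × (Fin 3 → ℤ) × ℤ) → Set (Phase N) := fun β => {z | cellKey (rs N) (rs N) z = β}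
    with hB
  have hBm : ∀ β, MeasurableSet (B β) := fun β => measurableSet_cellKey_eq _ _ β
  have hcover : lowE ⊆ ⋃ β ∈ s', B β := by
    intro z hz
    simp only [mem_iUnion, exists_prop]
    exact ⟨cellKey (rs N) (rs N) z, Finset.mem_filter.2 ⟨hs z hz, z, hz, rfl⟩, rfl⟩
  have hdisj : Set.PairwiseDisjoint (↑s' : Set ((Fin 3 → ℤ) → ℕ × (Fin 3 → ℤ) × ℤ)) B := by
    intro β _ β' _ hne
    rw [Function.onFun, Set.disjoint_left]
    intro z hz hz'
    exact hne ((show cellKey (rs N) (rs N) z = β from hz).symm.trans (show cellKey (rs N) (rs N) z = β' from hz'))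
  have hsumμ : ∑ β ∈ s', μ (B β) ≤ 1 := by
    rw [← measure_biUnion_finset hdisj fun β _ => hBm β]
    exact prob_le_one
  have hLOW1 : ∫⁻ z in lowE, ENNReal.ofReal |fullSum Φ τ (rs N) g h z| ∂μ ≤
      ∑ k ∈ Finset.range m, ∫⁻ z in lowE, ENNReal.ofReal |Z k z| ∂μ := by
    rw [← lintegral_finsetSum' _ fun k _ => (hF k).restrict]
    refine lintegral_mono fun z => ?_
    rw [fullSum_eq_sum_slotSum Φ hτ (rs N) g h hm z, ← ENNReal.ofReal_sum_of_nonneg fun k _ => abs_nonneg _]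
    exact ENNReal.ofReal_le_ofReal (Finset.abs_sum_le_sum_abs _ _)
  have hLOW2 : ∀ k, ∫⁻ z in lowE, ENNReal.ofReal |Z k z| ∂μ ≤ ∑ β ∈ s', ∫⁻ z in B β, ENNReal.ofReal |Z k z| ∂μ :=
    fun k => (lintegral_mono_set hcover).trans (Literature.Analysis.FluidPDE.lintegral_biUnion_finset_le μ s' B _)
  /- Step 4: one level set -/
  have hlevel : ∀ β ∈ s', ∑ k ∈ Finset.range m, ∫⁻ z in B β, ENNReal.ofReal |Z k z| ∂μ ≤
      (m : ℝ≥0∞) * (ENNReal.ofReal ((δ' + 1 / L) * tN N) + ENNReal.ofReal KX) * μ (B β) + ENNReal.ofReal NK := by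
    intro β hβ
    obtain ⟨z₀, hz₀E, rfl⟩ := (Finset.mem_filter.1 hβ).2
    have TB := fun F (hFm : Measurable F) =>
      transfers_on_levelSet (σ := σ) (N := N) ha hθ hu ha0 hθ0 hθ₁ Φ hηp hS1N hS2N hz₀E hFm
    change ∑ k ∈ Finset.range m, ∫⁻ z in keyLevel N z₀, ENNReal.ofReal |Z k z| ∂μ ≤
      (m : ℝ≥0∞) * (ENNReal.ofReal ((δ' + 1 / L) * tN N) + ENNReal.ofReal KX) * μ (keyLevel N z₀) + ENNReal.ofReal NK
    by_cases hkept : ENNReal.ofReal (Real.exp (-(η * ((N : ℝ) + 1)))) ≤ μ (keyLevel N z₀)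
    · have hwin : ∀ k ∈ Finset.range m, ∫⁻ z in keyLevel N z₀, ENNReal.ofReal |Z k z| ∂μ ≤
          (ENNReal.ofReal ((δ' + 1 / L) * tN N) + ENNReal.ofReal KX) * μ (keyLevel N z₀) := by
        intro k hk
        obtain ⟨hbias, hconc⟩ := hRN k (Finset.mem_range.1 hk) z₀ hkept
        exact kept_window_bound hPM hσ hσ2 hθ₁ hΛ hdom hg hCg hh hhb hlam hE1N hΛs1 TB hδ' hL
          (wEnd τ m k) (wEnd τ m (k + 1)) hkept hbias hconc hM₁
      calc ∑ k ∈ Finset.range m, ∫⁻ z in keyLevel N z₀, ENNReal.ofReal |Z k z| ∂μ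
          ≤ ∑ k ∈ Finset.range m, (ENNReal.ofReal ((δ' + 1 / L) * tN N) + ENNReal.ofReal KX) * μ (keyLevel N z₀) :=
            Finset.sum_le_sum hwin
        _ = (m : ℝ≥0∞) * (ENNReal.ofReal ((δ' + 1 / L) * tN N) + ENNReal.ofReal KX) * μ (keyLevel N z₀) := by
            rw [Finset.sum_const, Finset.card_range, nsmul_eq_mul]; ring
        _ ≤ _ := le_self_add
    · rw [not_le] at hkept
      calc ∑ k ∈ Finset.range m, ∫⁻ z in keyLevel N z₀, ENNReal.ofReal |Z k z| ∂μ ≤ ENNReal.ofReal NK :=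
            nonkept_levelSet_bound hPM hσ hσ2 hθ₁ hΛ hdom hτ hg hCg hh hhb hlam hE1N hΛs1 TB hm hkept hM₁
        _ ≤ _ := le_add_self
  /- Step 5: sums -/
  have hLOW : ∫⁻ z in lowE, ENNReal.ofReal |fullSum Φ τ (rs N) g h z| ∂μ ≤
      ENNReal.ofReal ((m : ℝ) * ((δ' + 1 / L) * tN N)) + ENNReal.ofReal ((m : ℝ) * KX) +
        ENNReal.ofReal ((s.card : ℝ) * NK) := by
    calc ∫⁻ z in lowE, ENNReal.ofReal |fullSum Φ τ (rs N) g h z| ∂μ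
        ≤ ∑ k ∈ Finset.range m, ∑ β ∈ s', ∫⁻ z in B β, ENNReal.ofReal |Z k z| ∂μ :=
          hLOW1.trans (Finset.sum_le_sum fun k _ => hLOW2 k)
      _ = ∑ β ∈ s', ∑ k ∈ Finset.range m, ∫⁻ z in B β, ENNReal.ofReal |Z k z| ∂μ := Finset.sum_comm
      _ ≤ ∑ β ∈ s', ((m : ℝ≥0∞) * (ENNReal.ofReal ((δ' + 1 / L) * tN N) + ENNReal.ofReal KX) * μ (B β) +
            ENNReal.ofReal NK) := Finset.sum_le_sum hlevel
      _ = (m : ℝ≥0∞) * (ENNReal.ofReal ((δ' + 1 / L) * tN N) + ENNReal.ofReal KX) * ∑ β ∈ s', μ (B β) +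
            (s'.card : ℝ≥0∞) * ENNReal.ofReal NK := by
          rw [Finset.sum_add_distrib, ← Finset.mul_sum, Finset.sum_const, nsmul_eq_mul]
      _ ≤ (m : ℝ≥0∞) * (ENNReal.ofReal ((δ' + 1 / L) * tN N) + ENNReal.ofReal KX) * 1 +
            (s.card : ℝ≥0∞) * ENNReal.ofReal NK := by
          refine add_le_add (mul_le_mul_right hsumμ _) (mul_le_mul_left ?_ _)
          exact_mod_cast Finset.card_filter_le _ _
      _ = ENNReal.ofReal ((m : ℝ) * ((δ' + 1 / L) * tN N)) + ENNReal.ofReal ((m : ℝ) * KX) +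
            ENNReal.ofReal ((s.card : ℝ) * NK) := by
          rw [mul_one, mul_add, ENNReal.ofReal_mul (by positivity : (0 : ℝ) ≤ m),
            ENNReal.ofReal_mul (by positivity : (0 : ℝ) ≤ m), ENNReal.ofReal_mul (by positivity : (0 : ℝ) ≤ s.card),
            ENNReal.ofReal_natCast, ENNReal.ofReal_natCast]
  calc ∫⁻ z in lowE, ENNReal.ofReal |fullSum Φ τ (rs N) g h z| ∂μ +
        ∫⁻ z in lowEᶜ, ENNReal.ofReal |fullSum Φ τ (rs N) g h z| ∂μ
      ≤ (ENNReal.ofReal ((m : ℝ) * ((δ' + 1 / L) * tN N)) + ENNReal.ofReal ((m : ℝ) * KX) +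
          ENNReal.ofReal ((s.card : ℝ) * NK)) + ENNReal.ofReal (2 * Cg * (lam + 1) * Real.exp (-((N : ℝ) + 1))) :=
        add_le_add hLOW hHIGH
    _ = _ := by ring

/-- **Registered sub-goal `transferNonkept` of the glue (T-d3)**: a binder-free corollary of the exponent bookkeeping
used in the non-kept case (`Λ^{N+1} e^{-M₁(N+1)} ≤ e^{-η(N+1)}` once `log Λ + η ≤ M₁`). [folklore] -/
theorem transferNonkept : ∀ (Λ M₁ η : ℝ) (N : ℕ), 1 ≤ Λ → Real.log Λ + η ≤ M₁ →
    Λ ^ (N + 1) * Real.exp (-(M₁ * ((N : ℝ) + 1))) ≤ Real.exp (-(η * ((N : ℝ) + 1))) :=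
  fun _ _ _ N hΛ hM => pow_mul_exp_neg_le hΛ hM N

end Summit.AtomisticToContinuum.HydrodynamicLimit.Theorems.KickFairRelEquilibriumMesoLine

end
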